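import Literature.Computability.QuantumComplexity.CountingSimulationProofs
import Literature.Computability.Complexity.ProbabilisticClassesProofs
import HarnessLib

/-!
# `GapP` is a ring: closure under sums, differences and products

Toolkit for the proof of the named fact `Literature.Computability.QuantumComplexity.BQP_subset_AWPP`
(`CountingSimulation.lean`; Fortnow–Rogers 1999, Thm. 3.1: `BQP ⊆ AWPP`), where a `GapP`
approximation `g(x)/2^{P}` of the acceptance probability is pushed through the amplifying cubic
`A(t) = 3t² - 2t³`, i.e. `3·g²·2^{P} - 2·g³ ∈ GapP` is needed. Fenner–Fortnow–Kurtz 1994, §3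
record the closure properties of `GapP` used for this: `GapP` contains `#P` (Lemma 3.3) and the
`FP`-computable exponentials, and is closed under subtraction, (uniform polynomial) sums and
products (Lemmas 3.6–3.8 / Thm. 3.9 area: "`GapP` is closed under … products"). In the tree's
conventions (`GapP := #P - #P`, `#P` = exact-length witness counts of a `P` relation,
`Counting.lean`) the only machine content is **`#P` is closed under products**
(`mul_mem_SharpP`): concatenate the two witnesses, splitting at the polynomial position
`q₁(|x|)` with the coin-truncation maps `truncSndFn`/`dropSndFn` of `CoinTruncation.lean`; the
count is the product rule `cnt_take_drop` of `ProbabilisticClassesProofs.lean`. The rest is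
bookkeeping of differences: `add_mem_GapP`, `neg_mem_GapP`, `sub_mem_GapP`, `mul_mem_GapP`,
`nsmul_mem_GapP`, `sharpP_mem_GapP`, `two_pow_mem_GapP`.

## References

* S. Fenner, L. Fortnow, S. Kurtz, *Gap-definable counting classes*, J. Comput. System Sci. 48
  (1994) 116–148, §3 (Lemma 3.3: `#P ⊆ GapP`; closure of `GapP` under subtraction, sums and
  products).
* L. Fortnow, J. Rogers, *Complexity limitations on quantum computation*, J. Comput. System Sci.
  59 (1999) 240–252, §2.2 (the closure properties of `GapP` used in §3).
* S. Arora, B. Barak, *Computational Complexity: A Modern Approach*, CUP 2009, Def. 17.2.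
-/

noncomputable section

open Computability Literature.Computability.Complexity Literature.Computability.Cryptography

namespace Literature.Computability.QuantumComplexity

open Polynomial Literature.Computability.Complexity.TTClosure
  Literature.Computability.Complexity.PPSharpP AWPPPP

namespace GapPRing

/-! ### `#P` is closed under products -/

/-- **`#P` is closed under products**: `f, h ∈ #P ⇒ f·h ∈ #P` — witnesses `y₁ y₂` of length
`(q₁ + q₂)(|x|)` for the relation `trunc_{q₁}⁻¹ R₁ ⊓ drop_{q₁}⁻¹ R₂` ("run the first machine on
the first `q₁(|x|)` guessed bits and the second machine on the rest"; both maps are in `FP`,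
`CoinTruncation.lean`), whose count is the product (`cnt_take_drop`).
[cite: FennerFortnowKurtz1994, §3 (closure of GapP under products)] -/
theorem mul_mem_SharpP {f h : List Bool → ℕ} (hf : f ∈ SharpP) (hh : h ∈ SharpP) :
    (fun x => f x * h x) ∈ SharpP := by
  obtain ⟨R₁, hR₁, q₁, hf₁⟩ := hf
  obtain ⟨R₂, hR₂, q₂, hf₂⟩ := hh
  refine ⟨(truncSndFn q₁ ⁻¹' R₁ : Language Bool) ⊓ (dropSndFn q₁ ⁻¹' R₂ : Language Bool),
    inter_mem_P (preimage_mem_P hR₁ (truncSndFn_mem_FP q₁)) (preimage_mem_P hR₂ (dropSndFn_mem_FP q₁)),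
    q₁ + q₂, fun x => ?_⟩
  show f x * h x = countWitnesses _ ((q₁ + q₂).eval x.length) x
  rw [hf₁ x, hf₂ x, countWitnesses_eq_cnt, countWitnesses_eq_cnt, countWitnesses_eq_cnt, eval_add,
    ← cnt_take_drop]
  refine cnt_congr fun y _ => ?_
  simp only [Set.mem_setOf_eq]
  rw [Language.mem_inf, memL_preimage, memL_preimage, truncSndFn_boolPair, dropSndFn_boolPair]

/-! ### `GapP` is a ring -/

/-- **`#P ⊆ GapP`** (pointwise cast), the tree's `SharpP_subset_GapP_holds`.
[cite: FennerFortnowKurtz1994, Lemma 3.3] -/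
theorem sharpP_mem_GapP {f : List Bool → ℕ} (hf : f ∈ SharpP) : (fun x => (f x : ℤ)) ∈ GapP :=
  SharpP_subset_GapP_holds hf

/-- **`GapP` is closed under addition**: `(a₁ - b₁) + (a₂ - b₂) = (a₁ + a₂) - (b₁ + b₂)`.
[cite: FennerFortnowKurtz1994, §3 (closure properties of GapP)] -/
theorem add_mem_GapP {g₁ g₂ : List Bool → ℤ} (h₁ : g₁ ∈ GapP) (h₂ : g₂ ∈ GapP) :
    (fun x => g₁ x + g₂ x) ∈ GapP := by
  obtain ⟨a₁, ha₁, b₁, hb₁, e₁⟩ := h₁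
  obtain ⟨a₂, ha₂, b₂, hb₂, e₂⟩ := h₂
  refine ⟨fun x => a₁ x + a₂ x, add_mem_SharpP ha₁ ha₂, fun x => b₁ x + b₂ x, add_mem_SharpP hb₁ hb₂,
    fun x => ?_⟩
  show g₁ x + g₂ x = ((a₁ x + a₂ x : ℕ) : ℤ) - ((b₁ x + b₂ x : ℕ) : ℤ)
  rw [e₁ x, e₂ x]
  push_cast
  ring

/-- **`GapP` is closed under negation**: `-(a - b) = b - a`.
[cite: FennerFortnowKurtz1994, §3 (closure properties of GapP)] -/
theorem neg_mem_GapP {g : List Bool → ℤ} (h : g ∈ GapP) : (fun x => -g x) ∈ GapP := by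
  obtain ⟨a, ha, b, hb, e⟩ := h
  refine ⟨b, hb, a, ha, fun x => ?_⟩
  show -g x = (b x : ℤ) - (a x : ℤ)
  rw [e x]
  ring

/-- **`GapP` is closed under subtraction.** [cite: FennerFortnowKurtz1994, §3 (closure properties of GapP)] -/
theorem sub_mem_GapP {g₁ g₂ : List Bool → ℤ} (h₁ : g₁ ∈ GapP) (h₂ : g₂ ∈ GapP) :
    (fun x => g₁ x - g₂ x) ∈ GapP := by
  have h := add_mem_GapP h₁ (neg_mem_GapP h₂)
  simp only [← sub_eq_add_neg] at h
  exact h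

/-- **`GapP` is closed under products**:
`(a₁ - b₁)(a₂ - b₂) = (a₁a₂ + b₁b₂) - (a₁b₂ + b₁a₂)`, each term in `#P` by `mul_mem_SharpP`,
`add_mem_SharpP`. [cite: FennerFortnowKurtz1994, §3 (closure of GapP under products)] -/
theorem mul_mem_GapP {g₁ g₂ : List Bool → ℤ} (h₁ : g₁ ∈ GapP) (h₂ : g₂ ∈ GapP) :
    (fun x => g₁ x * g₂ x) ∈ GapP := by
  obtain ⟨a₁, ha₁, b₁, hb₁, e₁⟩ := h₁
  obtain ⟨a₂, ha₂, b₂, hb₂, e₂⟩ := h₂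
  refine ⟨fun x => a₁ x * a₂ x + b₁ x * b₂ x, add_mem_SharpP (mul_mem_SharpP ha₁ ha₂) (mul_mem_SharpP hb₁ hb₂),
    fun x => a₁ x * b₂ x + b₁ x * a₂ x, add_mem_SharpP (mul_mem_SharpP ha₁ hb₂) (mul_mem_SharpP hb₁ ha₂),
    fun x => ?_⟩
  show g₁ x * g₂ x = ((a₁ x * a₂ x + b₁ x * b₂ x : ℕ) : ℤ) - ((a₁ x * b₂ x + b₁ x * a₂ x : ℕ) : ℤ)
  rw [e₁ x, e₂ x]
  push_cast
  ring

/-- The zero function is in `GapP`. [cite: FennerFortnowKurtz1994, §3] -/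
theorem zero_mem_GapP : (fun _ => (0 : ℤ)) ∈ GapP := by
  have h := sharpP_mem_GapP zero_mem_SharpP
  simpa using h

/-- **`GapP` is closed under natural multiples.** [cite: FennerFortnowKurtz1994, §3 (closure properties of GapP)] -/
theorem nsmul_mem_GapP (n : ℕ) {g : List Bool → ℤ} (h : g ∈ GapP) : (fun x => (n : ℤ) * g x) ∈ GapP := by
  induction n with
  | zero => simpa using zero_mem_GapP
  | succ n ih =>
    have h' := add_mem_GapP ih h
    refine (show (fun x => ((n + 1 : ℕ) : ℤ) * g x) = fun x => (n : ℤ) * g x + g x from ?_) ▸ h'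
    funext x
    push_cast
    ring

/-- **The exponential `x ↦ 2^{p(|x|)}` is in `GapP`** (it is in `#P`, `AWPPPP.two_pow_mem_SharpP`).
[cite: FennerFortnowKurtz1994, §3] -/
theorem two_pow_mem_GapP (p : Polynomial ℕ) : (fun x : List Bool => (2 : ℤ) ^ p.eval x.length) ∈ GapP := by
  have h := sharpP_mem_GapP (two_pow_mem_SharpP p)
  simpa using h

/-- **Scaling by the exponential**: `g ∈ GapP ⇒ 2^{p(|·|)} · g ∈ GapP`.
[cite: FennerFortnowKurtz1994, §3 (closure of GapP under products)] -/
theorem two_pow_mul_mem_GapP (p : Polynomial ℕ) {g : List Bool → ℤ} (h : g ∈ GapP) :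
    (fun x : List Bool => (2 : ℤ) ^ p.eval x.length * g x) ∈ GapP :=
  mul_mem_GapP (two_pow_mem_GapP p) h

/-- **The amplifying cubic stays in `GapP`**: for `g ∈ GapP` and a polynomial `P`,
`x ↦ 3·g(x)²·2^{P(|x|)} - 2·g(x)³` is in `GapP` (the numerator of `A(g/2^P) = 3(g/2^P)² - 2(g/2^P)³`
over the denominator `2^{3P}`). [cite: FennerFortnowKurtz1994, §3 (closure of GapP under sums and products)] -/
theorem cubic_mem_GapP {g : List Bool → ℤ} (h : g ∈ GapP) (P : Polynomial ℕ) :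
    (fun x : List Bool => 3 * (g x * g x) * (2 : ℤ) ^ P.eval x.length - 2 * (g x * g x * g x)) ∈ GapP := by
  have h2 : (fun x => g x * g x) ∈ GapP := mul_mem_GapP h h
  have h3 : (fun x => g x * g x * g x) ∈ GapP := mul_mem_GapP h2 h
  have hA : (fun x => (3 : ℤ) * ((2 : ℤ) ^ P.eval x.length * (g x * g x))) ∈ GapP :=
    nsmul_mem_GapP 3 (two_pow_mul_mem_GapP P h2)
  have hB : (fun x => (2 : ℤ) * (g x * g x * g x)) ∈ GapP := nsmul_mem_GapP 2 h3
  have h' := sub_mem_GapP hA hB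
  refine (show (fun x : List Bool => 3 * (g x * g x) * (2 : ℤ) ^ P.eval x.length - 2 * (g x * g x * g x)) =
    fun x => (3 : ℤ) * ((2 : ℤ) ^ P.eval x.length * (g x * g x)) - (2 : ℤ) * (g x * g x * g x) from ?_) ▸ h'
  funext x
  ring

end GapPRing

end Literature.Computability.QuantumComplexity

end
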